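import Literature.NumberTheory.Transcendental.KZLogCalculusProofs
import Literature.NumberTheory.Transcendental.KZRayDilog

/-!
# `OffTetraSectorKernel` (stmt-KontsevichZagierPeriods-10557), line `odd-hyperbolic-ladder`:
# the log bands exist (stub `stub_logBandsExist`)

For `k ≥ 1` and real algebraic `a, b` (`z = a + ib`, `g(s) = b / ((1 − s a)² + (s b)²) =
Im (z/(1 − s z))`) the two LOG BANDS

* `Band_k(a,b) = [{0 < s < 1, 1 ≤ u ≤ 1/s^k}, g(s)/u]` and
* `[{0 < t < 1, 1 ≤ u ≤ 1/t^k}, k t^{k−1} g(t^k)/u]`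

ARE Kontsevich–Zagier integral representations (`KZ.IntegralRep 2`). Both are literally the
unfolding `KZlog.IntegralRep.monomialRep` of an admissible logarithmic term `[(0,1); 0; (h, 1/s^k)]`
of `KZLogCalculus.lean` (`h = g`, resp. `h = k t^{k−1} g(t^k)`): the base `(0,1) ⊆ ℝ¹` is
`ℚ`-semialgebraic, `h` and `1/s^k ≥ 1` are `ℚ`-semialgebraic on it (real algebraic constants are
`ℚ`-definable; the denominator `(1 − s a)² + (s b)²` does not vanish for `b ≠ 0`, and `h = 0` for
`b = 0`), and the monomial `h · log(1/s^k) = −k h log s` is absolutely integrable on `(0,1)`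
(`h` is continuous on `[0,1]`, `log` is integrable at `0`).

References: M. Kontsevich, D. Zagier, *Periods* (2001), §1.1 ("introducing more variables",
`log 2 = ∫₁² dx/x`); D. Zagier, *The dilogarithm function* (2007), Ch. I §3.
No definitions are introduced.
-/

noncomputable section

open Set MeasureTheory MvPolynomial
open Literature.NumberTheory.Transcendental
open Literature.ModelTheory.ExponentialFields (IsSemialgebraic)

namespace Summit.KontsevichZagierPeriods.HyperbolicBloch.OffTetraSectorKernel

/-- On the base `(0,1)` the upper edge `1/s^k` of the log band is at least `1`. [folklore]
[cite: KontsevichZagier2001, §1.1] -/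
theorem logBandsExist_one_le_edge (k : ℕ) {x : Fin 1 → ℝ}
    (hx : x ∈ {x : Fin 1 → ℝ | 0 < x 0 ∧ x 0 < 1}) : 1 ≤ 1 / x 0 ^ k := by
  rw [le_div_iff₀ (pow_pos hx.1 k), one_mul]
  exact pow_le_one₀ hx.1.le hx.2.le

/-- For real algebraic `a, b` and a `ℚ`-semialgebraic function `u` on a `ℚ`-semialgebraic set `s`,
the function `b / ((1 − u a)² + (u b)²)` (`= Im (z/(1 − u z))`, `z = a + ib`) is `ℚ`-semialgebraic
on `s`: for `b ≠ 0` the denominator does not vanish (`KZ.rayDilog_den_pos`), for `b = 0` the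
function vanishes identically. [cite: KontsevichZagier2001, §1.1] -/
theorem logBandsExist_isSemialgebraicFunOn_kernel {a b : ℝ} (ha : IsAlgebraic ℚ a)
    (hb : IsAlgebraic ℚ b) {s : Set (Fin 1 → ℝ)} (hs : IsSemialgebraic ℚ s) {u : (Fin 1 → ℝ) → ℝ}
    (hu : IsSemialgebraicFunOn ℚ s u) :
    IsSemialgebraicFunOn ℚ s (fun x => b / ((1 - u x * a) ^ 2 + (u x * b) ^ 2)) := by
  by_cases hb0 : b = 0
  · refine (isSemialgebraicFunOn_natCast hs 0).congr fun x _ => ?_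
    simp [hb0]
  have haC := isSemialgebraicFunOn_const_of_isAlgebraic hs ha
  have hbC := isSemialgebraicFunOn_const_of_isAlgebraic hs hb
  have hden : IsSemialgebraicFunOn ℚ s (fun x => (1 - u x * a) ^ 2 + (u x * b) ^ 2) := by
    have e1 := IsSemialgebraicFunOn.sub_holds (isSemialgebraicFunOn_natCast hs 1)
      (IsSemialgebraicFunOn.mul_holds hu haC)
    have e2 := IsSemialgebraicFunOn.mul_holds hu hbC
    refine (IsSemialgebraicFunOn.add_holds (IsSemialgebraicFunOn.mul_holds e1 e1)
      (IsSemialgebraicFunOn.mul_holds e2 e2)).congr fun x _ => ?_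
    simp only [Pi.mul_apply, Pi.add_apply, Pi.sub_apply, Nat.cast_one]
    ring
  exact hbC.div hden fun x _ => (KZ.rayDilog_den_pos hb0 a (u x)).ne'

/-- **The log monomial is integrable.** For a continuous `φ : ℝ → ℝ`, the monomial
`φ(s) · log(1/s^k) = −k φ(s) log s` is absolutely integrable on the base `(0,1) ⊆ ℝ¹` (`φ` is
bounded on `[0,1]`, `log` is integrable at `0`; transported along `ℝ¹ ≃ ℝ`). [folklore]
[cite: KontsevichZagier2001, §1.1] -/
theorem logBandsExist_integrableOn_mul_log {φ : ℝ → ℝ} (hφ : Continuous φ) (k : ℕ) :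
    IntegrableOn (fun x : Fin 1 → ℝ => φ (x 0) * Real.log (1 / x 0 ^ k))
      {x : Fin 1 → ℝ | 0 < x 0 ∧ x 0 < 1} := by
  have h1 : IntegrableOn (fun s : ℝ => φ s * Real.log (1 / s ^ k)) (Ioo 0 1) := by
    have hc : ContinuousOn (fun s : ℝ => -(k : ℝ) * φ s) (uIcc 0 1) :=
      (continuous_const.mul hφ).continuousOn
    have h := (intervalIntegral.intervalIntegrable_log'.continuousOn_mul hc).1
    refine (h.mono_set Ioo_subset_Ioc_self).congr_fun (fun s _ => ?_) measurableSet_Ioo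
    rw [one_div, Real.log_inv, Real.log_pow]
    ring
  exact ((volume_preserving_funUnique (Fin 1) ℝ).integrableOn_comp_preimage
    (MeasurableEquiv.funUnique (Fin 1) ℝ).measurableEmbedding).2 h1

/-- The monomial `g(s) log(1/s^k)` of the first log band is absolutely integrable on `(0,1)`
(`g` is continuous: its denominator does not vanish for `b ≠ 0`, and `g = 0` for `b = 0`).
[cite: KontsevichZagier2001, §1.1] -/
theorem logBandsExist_integrableOn_monomial_one (a b : ℝ) (k : ℕ) :
    IntegrableOn (fun x : Fin 1 → ℝ =>
      b / ((1 - x 0 * a) ^ 2 + (x 0 * b) ^ 2) * Real.log (1 / x 0 ^ k))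
      {x : Fin 1 → ℝ | 0 < x 0 ∧ x 0 < 1} := by
  by_cases hb0 : b = 0
  · simp only [hb0, zero_div, zero_mul]
    exact integrableOn_zero
  have hφ : Continuous fun s : ℝ => b / ((1 - s * a) ^ 2 + (s * b) ^ 2) :=
    continuous_const.div (by fun_prop) fun s => (KZ.rayDilog_den_pos hb0 a s).ne'
  exact logBandsExist_integrableOn_mul_log hφ k

/-- The monomial `k t^{k−1} g(t^k) log(1/t^k)` of the second log band is absolutely integrable on
`(0,1)` (the coefficient is continuous on `ℝ`). [cite: KontsevichZagier2001, §1.1] -/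
theorem logBandsExist_integrableOn_monomial_two (a b : ℝ) (k : ℕ) :
    IntegrableOn (fun x : Fin 1 → ℝ =>
      k * x 0 ^ (k - 1) * (b / ((1 - x 0 ^ k * a) ^ 2 + (x 0 ^ k * b) ^ 2)) *
        Real.log (1 / x 0 ^ k))
      {x : Fin 1 → ℝ | 0 < x 0 ∧ x 0 < 1} := by
  by_cases hb0 : b = 0
  · simp only [hb0, zero_div, mul_zero, zero_mul]
    exact integrableOn_zero
  have hφ : Continuous fun s : ℝ =>
      k * s ^ (k - 1) * (b / ((1 - s ^ k * a) ^ 2 + (s ^ k * b) ^ 2)) :=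
    (continuous_const.mul (continuous_pow _)).mul
      (continuous_const.div (by fun_prop) fun s => (KZ.rayDilog_den_pos hb0 a (s ^ k)).ne')
  exact logBandsExist_integrableOn_mul_log hφ k

/-- **The first log band exists**: `[{0 < s < 1, 1 ≤ u ≤ 1/s^k}, g(s)/u]` is an integral
representation — the unfolding (`KZlog.IntegralRep.monomialRep`) of the admissible logarithmic
term `[(0,1); 0; (g, 1/s^k)]`. [cite: KontsevichZagier2001, §1.1] -/
theorem logBandsExist_one (k : ℕ) (a b : ℝ) (ha : IsAlgebraic ℚ a) (hb : IsAlgebraic ℚ b) :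
    ∃ Bk : KZ.IntegralRep 2,
      Bk.domain = {w | (0 < w 0 ∧ w 0 < 1) ∧ 1 ≤ w 1 ∧ w 1 ≤ 1 / w 0 ^ k} ∧
        Bk.integrand = fun w => b / ((1 - w 0 * a) ^ 2 + (w 0 * b) ^ 2) / w 1 := by
  have hσ : IsSemialgebraic ℚ {x : Fin 1 → ℝ | 0 < x 0 ∧ x 0 < 1} :=
    isSemialgebraic_unitInterval_fin_one
  have hv : IsSemialgebraicFunOn ℚ {x : Fin 1 → ℝ | 0 < x 0 ∧ x 0 < 1} (fun x => 1 / x 0 ^ k) := by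
    refine (isSemialgebraicFunOn_aeval_div_aeval hσ (1 : MvPolynomial (Fin 1) ℚ) (X 0 ^ k)
      fun x hx => ?_).congr fun x _ => by simp
    simpa using (pow_pos hx.1 k).ne'
  have hadm : (⟨{x : Fin 1 → ℝ | 0 < x 0 ∧ x 0 < 1}, fun _ => 0, 1,
      fun _ x => b / ((1 - x 0 * a) ^ 2 + (x 0 * b) ^ 2), fun _ x => 1 / x 0 ^ k⟩ :
      KZlog.Term 1).Admissible :=
    { isSemialgebraic_domain := hσ
      isSemialgebraicFunOn_h₀ := isSemialgebraicFunOn_const_of_isAlgebraic hσ isAlgebraic_zero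
      integrableOn_h₀ := integrableOn_zero
      isSemialgebraicFunOn_h := fun _ =>
        logBandsExist_isSemialgebraicFunOn_kernel ha hb hσ (isSemialgebraicFunOn_apply hσ 0)
      isSemialgebraicFunOn_v := fun _ => hv
      one_le_v := fun _ _ hx => logBandsExist_one_le_edge k hx
      integrableOn_monomial := fun _ => logBandsExist_integrableOn_monomial_one a b k }
  exact ⟨KZlog.IntegralRep.monomialRep ⟨_, hadm⟩ ⟨0, Nat.one_pos⟩, rfl, rfl⟩

/-- **The second log band exists**: `[{0 < t < 1, 1 ≤ u ≤ 1/t^k}, k t^{k−1} g(t^k)/u]` is an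
integral representation — the unfolding (`KZlog.IntegralRep.monomialRep`) of the admissible
logarithmic term `[(0,1); 0; (k t^{k−1} g(t^k), 1/t^k)]`. [cite: KontsevichZagier2001, §1.1] -/
theorem logBandsExist_two (k : ℕ) (a b : ℝ) (ha : IsAlgebraic ℚ a) (hb : IsAlgebraic ℚ b) :
    ∃ Bk : KZ.IntegralRep 2,
      Bk.domain = {w | (0 < w 0 ∧ w 0 < 1) ∧ 1 ≤ w 1 ∧ w 1 ≤ 1 / w 0 ^ k} ∧
        Bk.integrand = fun w =>
          k * w 0 ^ (k - 1) * (b / ((1 - w 0 ^ k * a) ^ 2 + (w 0 ^ k * b) ^ 2)) / w 1 := by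
  have hσ : IsSemialgebraic ℚ {x : Fin 1 → ℝ | 0 < x 0 ∧ x 0 < 1} :=
    isSemialgebraic_unitInterval_fin_one
  have hv : IsSemialgebraicFunOn ℚ {x : Fin 1 → ℝ | 0 < x 0 ∧ x 0 < 1} (fun x => 1 / x 0 ^ k) := by
    refine (isSemialgebraicFunOn_aeval_div_aeval hσ (1 : MvPolynomial (Fin 1) ℚ) (X 0 ^ k)
      fun x hx => ?_).congr fun x _ => by simp
    simpa using (pow_pos hx.1 k).ne'
  have hmon : IsSemialgebraicFunOn ℚ {x : Fin 1 → ℝ | 0 < x 0 ∧ x 0 < 1}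
      (fun x => (k : ℝ) * x 0 ^ (k - 1)) :=
    (isSemialgebraicFunOn_aeval hσ ((k : MvPolynomial (Fin 1) ℚ) * X 0 ^ (k - 1))).congr
      fun x _ => by simp
  have hpow : IsSemialgebraicFunOn ℚ {x : Fin 1 → ℝ | 0 < x 0 ∧ x 0 < 1} (fun x => x 0 ^ k) :=
    (isSemialgebraicFunOn_aeval hσ (X 0 ^ k : MvPolynomial (Fin 1) ℚ)).congr fun x _ => by simp
  have hh : IsSemialgebraicFunOn ℚ {x : Fin 1 → ℝ | 0 < x 0 ∧ x 0 < 1}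
      (fun x => k * x 0 ^ (k - 1) * (b / ((1 - x 0 ^ k * a) ^ 2 + (x 0 ^ k * b) ^ 2))) :=
    (IsSemialgebraicFunOn.mul_holds hmon
      (logBandsExist_isSemialgebraicFunOn_kernel ha hb hσ hpow)).congr fun x _ => by
        simp only [Pi.mul_apply]
  have hadm : (⟨{x : Fin 1 → ℝ | 0 < x 0 ∧ x 0 < 1}, fun _ => 0, 1,
      fun _ x => k * x 0 ^ (k - 1) * (b / ((1 - x 0 ^ k * a) ^ 2 + (x 0 ^ k * b) ^ 2)),
      fun _ x => 1 / x 0 ^ k⟩ : KZlog.Term 1).Admissible :=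
    { isSemialgebraic_domain := hσ
      isSemialgebraicFunOn_h₀ := isSemialgebraicFunOn_const_of_isAlgebraic hσ isAlgebraic_zero
      integrableOn_h₀ := integrableOn_zero
      isSemialgebraicFunOn_h := fun _ => hh
      isSemialgebraicFunOn_v := fun _ => hv
      one_le_v := fun _ _ hx => logBandsExist_one_le_edge k hx
      integrableOn_monomial := fun _ => logBandsExist_integrableOn_monomial_two a b k }
  exact ⟨KZlog.IntegralRep.monomialRep ⟨_, hadm⟩ ⟨0, Nat.one_pos⟩, rfl, rfl⟩

/-- STUB `stub_logBandsExist` (carriers): the log bands `[{0<s<1, 1 ≤ u ≤ 1/s^k}, g(s)/u]` and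
`[{0<t<1, 1 ≤ u ≤ 1/t^k}, k t^{k−1} g(t^k)/u]` ARE integral representations: `ℚ`-semialgebraic
data (algebraic `a, b`), and absolutely integrable — both are unfoldings
(`KZlog.IntegralRep.monomialRep`, Tonelli along the log sheet:
`KZlog.integrableOn_band_of_lintegral_fibre_le`) of admissible logarithmic terms on `(0,1)` whose
monomials `h log(1/s^k)` are integrable (`h` continuous on `[0,1]`, `log` integrable at `0`;
`h = 0` for `b = 0`). [cite: KontsevichZagier2001, §1.1] -/
theorem stub_logBandsExist :
    (∀ (k : ℕ), 1 ≤ k → ∀ (a b : ℝ), IsAlgebraic ℚ a → IsAlgebraic ℚ b →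
      ∃ Bk : KZ.IntegralRep 2, Bk.domain = {w | (0 < w 0 ∧ w 0 < 1) ∧ 1 ≤ w 1 ∧ w 1 ≤ 1 / w 0 ^ k} ∧
        Bk.integrand = fun w => b / ((1 - w 0 * a) ^ 2 + (w 0 * b) ^ 2) / w 1) ∧
    (∀ (k : ℕ), 1 ≤ k → ∀ (a b : ℝ), IsAlgebraic ℚ a → IsAlgebraic ℚ b →
      ∃ Bk : KZ.IntegralRep 2, Bk.domain = {w | (0 < w 0 ∧ w 0 < 1) ∧ 1 ≤ w 1 ∧ w 1 ≤ 1 / w 0 ^ k} ∧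
        Bk.integrand = fun w => k * w 0 ^ (k - 1) * (b / ((1 - w 0 ^ k * a) ^ 2 + (w 0 ^ k * b) ^ 2)) / w 1) :=
  ⟨fun k _ a b ha hb => logBandsExist_one k a b ha hb,
    fun k _ a b ha hb => logBandsExist_two k a b ha hb⟩

end Summit.KontsevichZagierPeriods.HyperbolicBloch.OffTetraSectorKernel

end
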